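/-
Copyright (c) 2026. All rights reserved.
Released under Apache 2.0 license as described in the file LICENSE.
-/
import Mathlib
import Literature.Combinatorics.Hinz2018.RegularToPerfect

/-!
# Hinz–Klavžar–Petr, *The Tower of Hanoi – Myths and Maths* (2018), 2.2.1: Noland's Problem

[cite: HinzKlavzarPetr2018, Ch. 2 §2.2.1 (pp. c. 115–118); Exercises 2.13–2.15, Ch. 9]

Andreas M. Hinz, Sandi Klavžar, Ciril Petr, *The Tower of Hanoi – Myths and Maths*, second
edition, Birkhäuser/Springer, Cham, 2018 (ISBN 978-3-319-73778-2), Chapter 2 «The Classical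
Tower of Hanoi», Section 2.2 «Regular to Perfect», subsection 2.2.1 «Noland's Problem», read
whole in the held text `book:hinz2018-tower-hanoi-myths-maths` (chunks p0114–p0117: from the
heading of 2.2.1 to the heading of 2.2.2 «Tower of Hanoi with Random Moves»), together with
Exercises 2.13–2.15 (chunk p0154) and their solutions in Chapter 9 (chunks p0329–p0332). The
layer of the held copy carries no page numbers here; from the neighbouring anchors (2.1.2 p. 99,
2.3 p. 120) the subsection occupies printed pp. c. 115–118 (±2) and the exercises p. c. 162, so
the cite tags below locate every result by its NUMBER in the book (Proposition 2.20, (2.8),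
Lemma 2.21, Proposition 2.22, Algorithm 11, Exercises 2.13–2.15), which is unambiguous. This
module continues the sibling `Hinz2018/RegularToPerfect` (§2.2 up to 2.2.1) and IMPORTS it: pegs
`T = ZMod 3`, states `s : ℕ → ZMod 3` (disc `d` at index `d`; the `n`-disc puzzle reads the
indices `1, …, n`), the operation `△` (`triOp`, with `triOp_self`, `triOp_of_ne`), Algorithm 10
as the structural recursions `p1Dist` (`μ = d(s, j^n)`) and `p1Aut` (the final state of the
P1-automaton) with `p1Dist_congr`, `p1Aut_congr`, `p1Aut_eq_foldr`, `p1Dist_succ_self`,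
`p1Dist_succ_of_ne`, `p1Dist_perfect`, `p1Dist_eq_zero_iff`, `exercise_2_10_a`, the optimal
solution `p1Path` (Theorem 2.7), state words `stateWord`, `stateOf` with `stateOf_snoc`,
`sum_stateOf_succ`, and Proposition 2.16 (`proposition_2_16`) are used BY NAME; so are
`thirdPeg`, `thirdPeg_spec`, `thirdPeg_thirdPeg`, `IsPerfectOn` of `Hinz2018/PerfectToPerfect`
(§2.1) and `pop_zero` of the `Warren2002` files.

## The text and what is typed (complete proofs; the numerical instances CHECKED by `decide`)

* **Proposition 2.20.** For `s ∈ T^N` with `s_d = d mod 2` for `d ∈ [N]`: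
  `d(s, s_N^N) = ⌊(3/7)2^N⌋`, `d(s, 2^N) = ⌊(5/7)2^N⌋`, `d(s, (1-s_N)^N) = ⌊(6/7)2^N⌋`
  (`proposition_2_20`, `proposition_2_20'`; `⌊·⌋` as natural-number division). The proof's
  quantities `x_N`, `y_N`, `z_N` are `nolandX`, `nolandY`, `nolandZ` (distances of the
  parity-sorted state `parityState`), its recursion («the largest disc will move at most once»)
  `noland_step`, the displayed recurrences `x_N = y_{N+1} - 2^N`, `x_{N+1} = z_N`,
  `x_{N+2} = y_N + 2^N`, `x_0 = 0, x_1 = 0, x_2 = 1, x_{N+3} = x_N + 3·2^N`,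
  `y_0 = 0, y_1 = 1, y_2 = 2, y_{N+3} = y_N + 5·2^N` (`noland_recurrence`), the six solved forms
  `x_{3n} = (3/7)(8^n - 1)`, …, `y_{3n+2} = (20/7)8^n - 6/7` (`noland_solved`), the worked sum
  `x_{3n} = 3 Σ_{k=0}^{n-1} 8^{n-1-k}` (`nolandX_three_mul`), the floors (`noland_closed`), and
  Lindquist's recurrence `t_0 = 0, t_1 = 2, t_2 = 11, t_{n+3} = t_n + 45·4^n` for `t_n = y_{2n}`
  (`lindquist`). The remark after the proof, «one finds that the best first move has idle peg
  (N+2) mod 3» in the task `s → 2^N`, is `noland_idle_peg` (the final state of the P1-automaton;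
  that this is the idle peg of the best first move is Theorem 2.10 of the sibling).
* **First goals and (2.8).** `(s △ j)_d = s_{d+1} △ ⋯ △ s_n △ j`, the state of the
  automaton before disc `d` is evaluated (`firstGoal`, `firstGoal_self`, `firstGoal_zero`,
  `firstGoal_succ`, `firstGoal_eq_foldr`), and **(2.8)**
  `d(s, j^n) = Σ_{d=1}^{n} (s_d ≠ (s △ j)_d) · 2^{d-1}`
  (`p1Dist_eq_sum_firstGoal`). **Lemma 2.21** (`d(s, i^n) = d(s, j^n) ⇔ s = (i △ j)^n`):
  `lemma_2_21` (our proof uses Exercise 2.10 a) of the sibling instead of (2.8)). Noland's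
  problem with `2n` discs through (2.8): `s_d = (s △ 2)_d ⇔ (2n - d) mod 3 = 1`
  (`noland_pattern`),
  `y_{2n} = 2^{2n} - 1 - Σ_{d=1}^{2n} ((2n-d) mod 3 = 1)·2^{d-1}` (`nolandY_two_mul`) and the
  displayed closed form `4^n (1 - (1/4) Σ_k 8^{-k}) - 1 = ⌊(5/7)4^n⌋`
  (`nolandY_two_mul_closed`, see OUR READING below).
* **Proposition 2.22** (the nearest perfect state of `s = 0^{n-d} s_d s̄ ≠ 0^n`: `j = s_d` if
  `n - d` is even, `j = 3 - s_d` otherwise): the peg `closerPeg`, the strict inequality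
  `d(s, j^n) < d(s, (3-j)^n)` (`proposition_2_22`, via the book's two-automata argument
  `p1Dist_leading_zeros`), the stated form (`proposition_2_22'`), «In particular» `j = s_n`
  if `s_n ≠ 0` (`closer_of_top_ne_zero`), and «The case of equality can only occur for»
  `s = 0^n` (`p1Dist_one_eq_two_iff`). **Algorithm 11** (`cp`) as the structural recursion
  `cpAux`/`cp` with its tit count `cpTits`; it returns the peg of Proposition 2.22 after
  `n - d + 1` tits (`cp_eq`) and is correct (`cp_spec`).
* **Exercises.** 2.13 (the sorting task of Figure 2.9: `d((02)^4, 1^8) = 182 = ⌊(5/7)2^8⌋`,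
  `exercise_2_13`; the structure of the optimal solution read off `p1Path`: discs `1–7`
  united on peg `2` after `54` moves, disc `8` moves once, the last move is disc `1` from peg
  `2`, so the inverse (sorting) task starts with disc `1` to peg `2`: `exercise_2_13_moves`; the
  cross-check
  `x_8, y_8, z_8 = 109, 182, 219`: `noland_values`). 2.14 (Stockmeyer): `Ψ(E) = Σ_{d∈E} 2^{d-1}`
  (`stockmeyerPsi`, `stockmeyerPsi_bounds`, `stockmeyerPsi_Icc`), (2.42)
  `d(s, j^n) ≥ Ψ(s^{-1}({i}))` (`exercise_2_14_a`) and (2.43), for every `E ⊆ [n]` a unique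
  state with `s^{-1}({i}) = E` and `d(s, j^n) = Ψ(E)` (`stockmeyerState`,
  `exercise_2_14_b_exists`, `exercise_2_14_b_unique`). 2.15 (average performance of
  Algorithm 11): exactly `2·3^{n-k}` states of `T^n ∖ {0^n}` stop after `k ∈ [n]` inputs
  (`exercise_2_15_count`), the tits read over all admissible inputs add up to `(3/2)(3^n-1) - n`
  (`exercise_2_15_total`, with `sum_cpTits`, `cpTits_perfect`, `exercise_2_15_by_stopping_time`),
  the two sums `Σ 3^k = (3^n-1)/2`, `Σ k3^k = (3+(2n-3)3^n)/4` and the value of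
  `Σ_{k=1}^{n} k·3^{n-k}` (`exercise_2_15_sums`, `exercise_2_15_value`), and the average
  `3/2 - n(3^n - 1)^{-1}` (`exercise_2_15`).

## Modelling decisions (OUR READING, said so)

* As in the siblings: pegs `ZMod 3`, `3 - j` as `-j`, states on all of `ℕ` with only the indices
  `1, …, n` being discs; `s_d = d mod 2` is `((d % 2 : ℕ) : ZMod 3)` (`parityState`), and in
  Proposition 2.20 the goal peg `s_N` is `N mod 2` (for `N = 0`, where the book's `s_0` does not
  exist, this reads `0`; all three distances are `0` there anyway).
* The first goal `(s △ j)_d` is DEFINED as the automaton run on the discs above `d`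
  (`p1Aut (n - d) (e ↦ s_{e+d}) j`) and proved to satisfy the displayed fold
  (`firstGoal_eq_foldr`).
* Algorithm 11's `while` loop is typed as a structural recursion from disc `n` downwards carrying
  the parity bit `b`; its last line `j = 1 + (b ⊻ (s_d - 1))` is typed as the case distinction it
  denotes (`s_d` for `b = 0`, `3 - s_d` for `b = 1`). On the excluded input `0^n` our `cp` returns
  `0` and `cpTits` counts `n` tits; Exercise 2.15's totals are typed both over all of `T^n` and
  over `T^n ∖ {0^n}` (the states with `d(s, 0^n) ≠ 0`).
* In the last display of 2.2.1 the inner sum is READ as `Σ_{k=0}^{⌊2(n-1)/3⌋} 8^{-k}`: the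
  layer of the held copy prints the lower limit `k = 1`, which contradicts the line above it (at
  `n = 1` it would give `y_2 = 3` instead of `2`); with `k = 0` the display is a theorem
  (`nolandY_two_mul_closed`, for `n ≥ 1`).
* (2.43)'s `∃₁ s ∈ T^n` is typed as an explicit state (`stockmeyerState`, our top-down
  construction following the Chapter 9 solution: discs of `E` on `i`, the others on the current
  goal) plus uniqueness on the discs `1, …, n`.
* Exercise 2.13 concerns the inverse task `1^8 → (02)^4`; distances between arbitrary states are
  not available in the siblings, so the optimal solution is typed in the direction `(02)^4 → 1^8`
  (`p1Path`, unique by Theorem 2.7) and the book's first move is our last move reversed (legal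
  moves are symmetric, `HanoiMove.symm` of the sibling).

## NOT TYPED (said so)

The Remark after Proposition 2.20 (history: [108], Noland [323], van Zanten [448], Obara and
Hirayama [326], Poole [342], Lindquist [269]; the psychological observation; Figure 2.9 as a
picture) except its mathematical content as listed; the attributions [128], [194, Theorem 3],
[404], [62], [162, (2.26)], [277]; Lu's algorithm [277, Section 4]; the further estimates (9.3),
(9.4), (9.5) and the counts `2^n`, `2^{n+1} - 1`, `4^n` in the Chapter 9 discussion of
Exercise 2.14; Lemma 2.18 c) and Lemma 2.19 (limits; before 2.2.1, not typed in the sibling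
either); and everything from 2.2.2 «Tower of Hanoi with Random Moves» on, which is a later anchor.
-/

namespace Literature.Combinatorics.Hinz2018

open Finset
open Literature.ComputerArithmetic.Warren2002 (pop pop_zero)

/-! ## Proposition 2.20: towers sorted by parity -/

/-- The state of Proposition 2.20 and of Noland's problem: disc `d` lies on peg `d mod 2` (even
discs on peg `0`, odd discs on peg `1`).
[cite: HinzKlavzarPetr2018, Ch. 2 §2.2.1 Prop. 2.20 (proof)] -/
def parityState (d : ℕ) : ZMod 3 := ((d % 2 : ℕ) : ZMod 3)

/-- `x_N := d(s, s_N^N)` for the parity-sorted state `s` (with `s_N = N mod 2`; for `N = 0` the goal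
peg is `0`). [cite: HinzKlavzarPetr2018, Ch. 2 §2.2.1 Prop. 2.20 (proof)] -/
def nolandX (N : ℕ) : ℕ := p1Dist N parityState (parityState N)

/-- `y_N := d(s, 2^N)` for the parity-sorted state `s`: the length of Noland's problem.
[cite: HinzKlavzarPetr2018, Ch. 2 §2.2.1 Prop. 2.20 (proof)] -/
def nolandY (N : ℕ) : ℕ := p1Dist N parityState 2

/-- `z_N := d(s, (1 - s_N)^N)` for the parity-sorted state `s`.
[cite: HinzKlavzarPetr2018, Ch. 2 §2.2.1 Prop. 2.20 (proof)] -/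
def nolandZ (N : ℕ) : ℕ := p1Dist N parityState (1 - parityState N)

/-- Values of `△` used below. [folklore] -/
private theorem triOp_vals₂ : triOp 1 2 = (0 : ZMod 3) ∧ triOp 0 2 = (1 : ZMod 3) ∧
    triOp 1 0 = (2 : ZMod 3) ∧ triOp 0 1 = (2 : ZMod 3) := by
  unfold triOp; decide

/-- `s_N ∈ {0, 1}`. [cite: HinzKlavzarPetr2018, Ch. 2 §2.2.1 Prop. 2.20 (proof)] -/
theorem parityState_eq (N : ℕ) :
    (N % 2 = 0 ∧ parityState N = 0) ∨ (N % 2 = 1 ∧ parityState N = 1) := by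
  unfold parityState
  rcases Nat.mod_two_eq_zero_or_one N with h | h
  · left; rw [h]; exact ⟨rfl, Nat.cast_zero⟩
  · right; rw [h]; exact ⟨rfl, Nat.cast_one⟩

/-- `s_{N+1} = 1 - s_N`. [cite: HinzKlavzarPetr2018, Ch. 2 §2.2.1 Prop. 2.20 (proof)] -/
theorem parityState_succ (N : ℕ) : parityState (N + 1) = 1 - parityState N := by
  rcases parityState_eq N with ⟨h, hP⟩ | ⟨h, hP⟩
  · rw [hP]; unfold parityState; rw [show (N + 1) % 2 = 1 by omega]; simp
  · rw [hP]; unfold parityState; rw [show (N + 1) % 2 = 0 by omega]; simp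

/-- The recursion of the proof of Proposition 2.20 («the largest disc will move at most once»):
`x_{N+1} = z_N`, `y_{N+1} = 2^N + x_N` (the book's `x_N = y_{N+1} - 2^N`), `z_{N+1} = 2^N + y_N`
(the book's `x_{N+2} = y_N + 2^N` combined with the first).
[cite: HinzKlavzarPetr2018, Ch. 2 §2.2.1 Prop. 2.20 (proof)] -/
theorem noland_step (N : ℕ) :
    nolandX (N + 1) = nolandZ N ∧ nolandY (N + 1) = 2 ^ N + nolandX N ∧
      nolandZ (N + 1) = 2 ^ N + nolandY N := by
  obtain ⟨t12, t02, t10, t01⟩ := triOp_vals₂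
  have h1 := parityState_succ N
  simp only [nolandX, nolandY, nolandZ, p1Dist, h1]
  rcases parityState_eq N with ⟨-, hP⟩ | ⟨-, hP⟩
  · rw [hP]
    simp only [sub_zero, triOp_self, if_true, zero_add, sub_self]
    refine ⟨trivial, ?_, ?_⟩
    · rw [if_neg (by decide), t12]
    · rw [if_neg (by decide), t10]
  · rw [hP]
    simp only [sub_self, triOp_self, if_true, zero_add, sub_zero]
    refine ⟨trivial, ?_, ?_⟩
    · rw [if_neg (by decide), t02]
    · rw [if_neg (by decide), t01]

/-- Proposition 2.20, closed forms: `x_N = ⌊(3/7)2^N⌋`, `y_N = ⌊(5/7)2^N⌋`, `z_N = ⌊(6/7)2^N⌋`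
(natural-number division). [cite: HinzKlavzarPetr2018, Ch. 2 §2.2.1 Prop. 2.20] -/
theorem noland_closed (N : ℕ) :
    nolandX N = 3 * 2 ^ N / 7 ∧ nolandY N = 5 * 2 ^ N / 7 ∧ nolandZ N = 6 * 2 ^ N / 7 := by
  induction N with
  | zero => simp [nolandX, nolandY, nolandZ, p1Dist]
  | succ N ih =>
    obtain ⟨hx, hy, hz⟩ := ih
    obtain ⟨e1, e2, e3⟩ := noland_step N
    rw [e1, e2, e3, hx, hy, hz, pow_succ]
    omega

/-- **Proposition 2.20.** For `s ∈ T^N` with `s_d = d mod 2` for all `d ∈ [N]`: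
`d(s, s_N^N) = ⌊(3/7)2^N⌋`, `d(s, 2^N) = ⌊(5/7)2^N⌋`, `d(s, (1-s_N)^N) = ⌊(6/7)2^N⌋`; here
`s_N = parityState N = N mod 2` (natural-number division for `⌊·⌋`).
[cite: HinzKlavzarPetr2018, Ch. 2 §2.2.1 Prop. 2.20] -/
theorem proposition_2_20 {N : ℕ} {s : ℕ → ZMod 3}
    (hs : ∀ d, 1 ≤ d → d ≤ N → s d = ((d % 2 : ℕ) : ZMod 3)) :
    p1Dist N s (parityState N) = 3 * 2 ^ N / 7 ∧ p1Dist N s 2 = 5 * 2 ^ N / 7 ∧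
      p1Dist N s (1 - parityState N) = 6 * 2 ^ N / 7 := by
  have hc : ∀ j, p1Dist N s j = p1Dist N parityState j :=
    fun j => p1Dist_congr (t := parityState) hs j
  rw [hc, hc, hc]
  exact noland_closed N

/-- Proposition 2.20 with the goal pegs read off the state itself (`N ≥ 1`): `d(s, s_N^N)` and
`d(s, (1 - s_N)^N)`. [cite: HinzKlavzarPetr2018, Ch. 2 §2.2.1 Prop. 2.20] -/
theorem proposition_2_20' {N : ℕ} (hN : 1 ≤ N) {s : ℕ → ZMod 3}
    (hs : ∀ d, 1 ≤ d → d ≤ N → s d = ((d % 2 : ℕ) : ZMod 3)) :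
    p1Dist N s (s N) = 3 * 2 ^ N / 7 ∧ p1Dist N s 2 = 5 * 2 ^ N / 7 ∧
      p1Dist N s (1 - s N) = 6 * 2 ^ N / 7 := by
  have h : s N = parityState N := hs N hN le_rfl
  rw [h]
  exact proposition_2_20 hs

/-- The displayed recurrences: `x_N = y_{N+1} - 2^N`, `x_{N+1} = z_N`, `x_{N+2} = y_N + 2^N`, and
consequently `x_0 = 0`, `x_1 = 0`, `x_2 = 1`, `x_{N+3} = x_N + 3·2^N`; `y_0 = 0`, `y_1 = 1`,
`y_2 = 2`, `y_{N+3} = y_N + 5·2^N`. [cite: HinzKlavzarPetr2018, Ch. 2 §2.2.1 Prop. 2.20 (proof)] -/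
theorem noland_recurrence (N : ℕ) :
    (nolandX N = nolandY (N + 1) - 2 ^ N ∧ nolandX (N + 1) = nolandZ N ∧
      nolandX (N + 2) = nolandY N + 2 ^ N) ∧
    (nolandX 0 = 0 ∧ nolandX 1 = 0 ∧ nolandX 2 = 1 ∧ nolandX (N + 3) = nolandX N + 3 * 2 ^ N) ∧
    (nolandY 0 = 0 ∧ nolandY 1 = 1 ∧ nolandY 2 = 2 ∧ nolandY (N + 3) = nolandY N + 5 * 2 ^ N) := by
  have h0 := noland_closed 0
  have h1 := noland_closed 1
  have h2 := noland_closed 2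
  have hN := noland_closed N
  have hN1 := noland_closed (N + 1)
  have hN2 := noland_closed (N + 2)
  have hN3 := noland_closed (N + 3)
  simp only [pow_succ, pow_zero] at *
  omega

/-- `8^n ≡ 1 (mod 7)`. [folklore] -/
private theorem eight_pow_mod_seven (n : ℕ) : 8 ^ n % 7 = 1 := by
  induction n with
  | zero => rfl
  | succ n ih => rw [pow_succ, Nat.mul_mod, ih]

/-- The six solved recurrences: `x_{3n} = (3/7)(8^n - 1)`, `x_{3n+1} = (6/7)(8^n - 1)`,
`x_{3n+2} = (12/7)8^n - 5/7`, `y_{3n} = (5/7)(8^n - 1)`, `y_{3n+1} = (10/7)8^n - 3/7`,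
`y_{3n+2} = (20/7)8^n - 6/7` (cleared of denominators).
[cite: HinzKlavzarPetr2018, Ch. 2 §2.2.1 Prop. 2.20 (proof)] -/
theorem noland_solved (n : ℕ) :
    (7 * nolandX (3 * n) + 3 = 3 * 8 ^ n ∧ 7 * nolandX (3 * n + 1) + 6 = 6 * 8 ^ n ∧
      7 * nolandX (3 * n + 2) + 5 = 12 * 8 ^ n) ∧
    (7 * nolandY (3 * n) + 5 = 5 * 8 ^ n ∧ 7 * nolandY (3 * n + 1) + 3 = 10 * 8 ^ n ∧
      7 * nolandY (3 * n + 2) + 6 = 20 * 8 ^ n) := by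
  have h8 := eight_pow_mod_seven n
  have e0 : 2 ^ (3 * n) = 8 ^ n := by rw [pow_mul]; norm_num
  have a0 := noland_closed (3 * n)
  have a1 := noland_closed (3 * n + 1)
  have a2 := noland_closed (3 * n + 2)
  rw [pow_succ, pow_succ, e0] at a2
  rw [pow_succ, e0] at a1
  rw [e0] at a0
  omega

/-- The worked example: `x_{3n} = 3 Σ_{k=0}^{n-1} 8^{n-1-k} = (3/7)(8^n - 1)` (Lemma 2.18 a) with
`α = 1`, `β = 8`). [cite: HinzKlavzarPetr2018, Ch. 2 §2.2.1 Prop. 2.20 (proof)] -/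
theorem nolandX_three_mul (n : ℕ) :
    nolandX (3 * n) = 3 * ∑ k ∈ range n, 8 ^ (n - 1 - k) ∧
      7 * (3 * ∑ k ∈ range n, 8 ^ (n - 1 - k)) = 3 * (8 ^ n - 1) := by
  have hs : ∑ k ∈ range n, 8 ^ (n - 1 - k) = ∑ k ∈ range n, 8 ^ k :=
    Finset.sum_range_reflect (fun k => 8 ^ k) n
  have hg : ∑ k ∈ range n, 8 ^ k = (8 ^ n - 1) / 7 := by
    rw [Nat.geomSum_eq (by norm_num) n]
  have h8 := eight_pow_mod_seven n
  have h1 : 1 ≤ 8 ^ n := Nat.one_le_pow _ _ (by norm_num)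
  have hx := (noland_solved n).1.1
  rw [hs, hg]
  omega

/-- Lindquist's recurrence for `t_n := y_{2n}`: `t_0 = 0`, `t_1 = 2`, `t_2 = 11` (i.e. `y_0`,
`y_2`, `y_4`) and `t_{n+3} = t_n + 45·4^n`.
[cite: HinzKlavzarPetr2018, Ch. 2 §2.2.1 after Prop. 2.20 (Lindquist [269])] -/
theorem lindquist (n : ℕ) :
    nolandY 0 = 0 ∧ nolandY 2 = 2 ∧ nolandY 4 = 11 ∧
      nolandY (2 * (n + 3)) = nolandY (2 * n) + 45 * 4 ^ n := by
  have e0 : 2 ^ (2 * n) = 4 ^ n := by rw [pow_mul]; norm_num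
  have e3 : 2 ^ (2 * (n + 3)) = 64 * 4 ^ n := by
    rw [show 2 * (n + 3) = 2 * n + 6 by ring, pow_add, pow_mul]; norm_num; ring
  have a := (noland_closed (2 * n)).2.1
  have b := (noland_closed (2 * (n + 3))).2.1
  have c0 := (noland_closed 0).2.1
  have c1 := (noland_closed 2).2.1
  have c2 := (noland_closed 4).2.1
  rw [e0] at a
  rw [e3] at b
  norm_num at c0 c1 c2
  omega

/-! ## First goals and formula (2.8) -/

/-- The first goal `(s △ j)_d` of disc `d` (cf. [128]): the state of the P1-automaton immediately
before the evaluation of disc `d` in Algorithm 10 run on `s ∈ T^n` with goal `j`, i.e.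
`(s △ j)_d = s_{d+1} △ ⋯ △ s_n △ j` for `d ∈ [n]`, and `(s △ j)_0 = s_1 △ ⋯ △ s_n △ j`.
[cite: HinzKlavzarPetr2018, Ch. 2 §2.2.1 (2.8)] -/
def firstGoal (n : ℕ) (s : ℕ → ZMod 3) (j : ZMod 3) (d : ℕ) : ZMod 3 :=
  p1Aut (n - d) (fun e => s (e + d)) j

/-- `(s △ j)_n = j`. [cite: HinzKlavzarPetr2018, Ch. 2 §2.2.1 (2.8)] -/
theorem firstGoal_self (n : ℕ) (s : ℕ → ZMod 3) (j : ZMod 3) : firstGoal n s j n = j := by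
  simp [firstGoal, p1Aut]

/-- `(s △ j)_0 = s_1 △ ⋯ △ s_n △ j` «is the idle peg in the best first move» (the final state of
the automaton, `p1Aut`; cf. Theorem 2.10, `theorem_2_10`).
[cite: HinzKlavzarPetr2018, Ch. 2 §2.2.1 (2.8)] -/
theorem firstGoal_zero (n : ℕ) (s : ℕ → ZMod 3) (j : ZMod 3) : firstGoal n s j 0 = p1Aut n s j := by
  simp [firstGoal]

/-- Peeling the smallest input: `s_1 △ (s_2 △ ⋯ △ s_{m+1} △ j)`. [folklore] -/
private theorem p1Aut_succ_shift (m : ℕ) (t : ℕ → ZMod 3) (j : ZMod 3) :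
    p1Aut (m + 1) t j = triOp (t 1) (p1Aut m (fun e => t (e + 1)) j) := by
  induction m generalizing j with
  | zero => simp [p1Aut]
  | succ m ih =>
    show p1Aut (m + 1) t (triOp (t (m + 2)) j) =
      triOp (t 1) (p1Aut m (fun e => t (e + 1)) (triOp (t (m + 1 + 1)) j))
    exact ih _

/-- `(s △ j)_d = s_{d+1} △ (s △ j)_{d+1}` for `d < n`.
[cite: HinzKlavzarPetr2018, Ch. 2 §2.2.1 (2.8)] -/
theorem firstGoal_succ {n : ℕ} (s : ℕ → ZMod 3) (j : ZMod 3) {d : ℕ} (hd : d < n) :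
    firstGoal n s j d = triOp (s (d + 1)) (firstGoal n s j (d + 1)) := by
  unfold firstGoal
  obtain ⟨m, hm⟩ : ∃ m, n - d = m + 1 := ⟨n - d - 1, by omega⟩
  rw [hm, show n - (d + 1) = m by omega, p1Aut_succ_shift]
  have e1 : (fun e : ℕ => s (e + 1 + d)) = fun e => s (e + (d + 1)) := by
    funext e; congr 1; omega
  show triOp (s (1 + d)) (p1Aut m (fun e => s (e + 1 + d)) j) = _
  rw [e1, Nat.add_comm 1 d]

/-- `(s △ j)_d = s_{d+1} △ ⋯ △ s_n △ j`, read from the right (Remark 2.12, `p1Aut_eq_foldr`).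
[cite: HinzKlavzarPetr2018, Ch. 2 §2.2.1 (2.8)] -/
theorem firstGoal_eq_foldr (n : ℕ) (s : ℕ → ZMod 3) (j : ZMod 3) (d : ℕ) :
    firstGoal n s j d = ((List.range (n - d)).map fun t => s (t + d + 1)).foldr triOp j := by
  unfold firstGoal
  rw [p1Aut_eq_foldr]
  congr 2
  funext t
  show s (t + 1 + d) = s (t + d + 1)
  congr 1; omega

/-- Peeling the largest disc in a first goal. [folklore] -/
private theorem firstGoal_top (n : ℕ) (s : ℕ → ZMod 3) (j : ZMod 3) {d : ℕ} (hd : d ≤ n) :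
    firstGoal (n + 1) s j d = firstGoal n s (triOp (s (n + 1)) j) d := by
  unfold firstGoal
  rw [show n + 1 - d = (n - d) + 1 by omega, p1Aut]
  show p1Aut (n - d) (fun e => s (e + d)) (triOp (s (n - d + 1 + d)) j) = _
  rw [show n - d + 1 + d = n + 1 by omega]

/-- **(2.8)** (cf. [194, Theorem 3]): `d(s, j^n) = Σ_{d=1}^{n} (s_d ≠ (s △ j)_d) · 2^{d-1}`.
[cite: HinzKlavzarPetr2018, Ch. 2 §2.2.1 (2.8)] -/
theorem p1Dist_eq_sum_firstGoal (n : ℕ) (s : ℕ → ZMod 3) (j : ZMod 3) :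
    p1Dist n s j = ∑ d ∈ Icc 1 n, if s d ≠ firstGoal n s j d then 2 ^ (d - 1) else 0 := by
  induction n generalizing j with
  | zero => simp [p1Dist]
  | succ n ih =>
    rw [Finset.sum_Icc_succ_top (by omega), firstGoal_self, p1Dist, ih (triOp (s (n + 1)) j)]
    have hc : ∑ d ∈ Icc 1 n, (if s d ≠ firstGoal (n + 1) s j d then 2 ^ (d - 1) else 0) =
        ∑ d ∈ Icc 1 n, (if s d ≠ firstGoal n s (triOp (s (n + 1)) j) d then 2 ^ (d - 1) else 0) :=
      Finset.sum_congr rfl (fun d hd => by rw [firstGoal_top n s j (Finset.mem_Icc.mp hd).2])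
    rw [hc, Nat.add_sub_cancel, add_comm]
    by_cases h : s (n + 1) = j <;> simp [h]

/-! ## Lemma 2.21 -/

/-- **Lemma 2.21** («another characterization of perfect states»): for `s ∈ T^n`, `n ∈ ℕ_0` and
`{i, j} ∈ (T choose 2)`, `d(s, i^n) = d(s, j^n) ⇔ s = (i △ j)^n`. (Proof: ours, from
Exercise 2.10 a) of the sibling, `exercise_2_10_a`, and `p1Dist_perfect`; the book argues with
(2.8).) [cite: HinzKlavzarPetr2018, Ch. 2 §2.2.1 Lemma 2.21] -/
theorem lemma_2_21 (n : ℕ) (s : ℕ → ZMod 3) {i j : ZMod 3} (hij : i ≠ j) :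
    p1Dist n s i = p1Dist n s j ↔ IsPerfectOn n s (triOp i j) := by
  rw [triOp_of_ne hij]
  rcases Nat.eq_zero_or_pos n with rfl | hn
  · simp only [p1Dist, true_iff]
    intro d h1 h0; omega
  · constructor
    · intro h
      by_contra hs
      exact exercise_2_10_a hn s hij hs h
    · intro h
      rw [p1Dist_perfect h i, p1Dist_perfect h j, if_neg (thirdPeg_spec i j hij).1,
        if_neg (thirdPeg_spec i j hij).2.1]

/-! ## The P1-automaton on the parity-sorted states -/

/-- The P1-automaton fed a parity pattern: a table indexed by the parity `a` of the index shift
and by the number of inputs modulo `6`. [folklore] -/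
private def parityAut : ℕ → ℕ → ZMod 3 → ZMod 3
  | 0, 1, j => 2 - j
  | 0, 2, j => 2 + j
  | 0, 3, j => 1 - j
  | 0, 4, j => 1 + j
  | 0, 5, j => -j
  | 1, 1, j => -j
  | 1, 2, j => 1 + j
  | 1, 3, j => 1 - j
  | 1, 4, j => 2 + j
  | 1, 5, j => 2 - j
  | _, _, j => j

/-- One more input of the parity pattern. [folklore] -/
private theorem parityAut_step : ∀ a < 2, ∀ r < 6, ∀ j : ZMod 3,
    parityAut a ((r + 1) % 6) j = parityAut a r (triOp (((r + 1 + a) % 2 : ℕ) : ZMod 3) j) := by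
  decide

/-- No input. [folklore] -/
private theorem parityAut_zero (a : ℕ) (ha : a < 2) (j : ZMod 3) : parityAut a 0 j = j := by
  interval_cases a <;> rfl

/-- The automaton fed `m` tits of the parity pattern shifted by `c`. [folklore] -/
private theorem p1Aut_parity (c m : ℕ) (j : ZMod 3) :
    p1Aut m (fun e => (((e + c) % 2 : ℕ) : ZMod 3)) j = parityAut (c % 2) (m % 6) j := by
  induction m generalizing j with
  | zero => rw [p1Aut, Nat.zero_mod, parityAut_zero _ (Nat.mod_lt _ (by norm_num))]
  | succ m ih =>
    rw [p1Aut, ih]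
    have hr : m % 6 < 6 := Nat.mod_lt _ (by norm_num)
    have ha : c % 2 < 2 := Nat.mod_lt _ (by norm_num)
    have h1 : (m + 1) % 6 = (m % 6 + 1) % 6 := by omega
    have h2 : (m + 1 + c) % 2 = (m % 6 + 1 + c % 2) % 2 := by omega
    show parityAut (c % 2) (m % 6) (triOp (((m + 1 + c) % 2 : ℕ) : ZMod 3) j) =
      parityAut (c % 2) ((m + 1) % 6) j
    rw [h1, h2]
    exact (parityAut_step (c % 2) ha (m % 6) hr _).symm

/-- In the task `s → 2^N` from the parity-sorted state (the sequence `y_N`) «one finds that the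
best first move has idle peg (N+2) mod 3»: the final state of the P1-automaton (the idle peg of
the best first move by Theorem 2.10, `theorem_2_10`) is `(N + 2) mod 3`.
[cite: HinzKlavzarPetr2018, Ch. 2 §2.2.1, remark after Prop. 2.20; §2.2 Thm. 2.10] -/
theorem noland_idle_peg {N : ℕ} {s : ℕ → ZMod 3}
    (hs : ∀ d, 1 ≤ d → d ≤ N → s d = ((d % 2 : ℕ) : ZMod 3)) :
    p1Aut N s 2 = ((N + 2 : ℕ) : ZMod 3) := by
  rw [p1Aut_congr (n := N) (s := s) (t := fun e => (((e + 0) % 2 : ℕ) : ZMod 3))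
    (fun d h1 h2 => hs d h1 h2) 2, p1Aut_parity 0 N 2, Nat.zero_mod, ← ZMod.natCast_mod (N + 2) 3,
    show (N + 2) % 3 = (N % 6 + 2) % 3 by omega]
  have hr : N % 6 < 6 := Nat.mod_lt _ (by norm_num)
  generalize N % 6 = r at hr ⊢
  interval_cases r <;> decide

/-- Noland's problem with `2n` discs read through the first goals:
`∀ d ∈ [2n] : s_d = (s △ 2)_d ⇔ (2n - d) mod 3 = 1`.
[cite: HinzKlavzarPetr2018, Ch. 2 §2.2.1, Noland's problem via (2.8)] -/
theorem noland_pattern (n : ℕ) {s : ℕ → ZMod 3}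
    (hs : ∀ d, 1 ≤ d → d ≤ 2 * n → s d = ((d % 2 : ℕ) : ZMod 3)) {d : ℕ} (hd1 : 1 ≤ d)
    (hd : d ≤ 2 * n) : s d = firstGoal (2 * n) s 2 d ↔ (2 * n - d) % 3 = 1 := by
  unfold firstGoal
  rw [p1Aut_congr (n := 2 * n - d) (s := fun e => s (e + d))
    (t := fun e => (((e + d) % 2 : ℕ) : ZMod 3))
    (fun e h1 h2 => hs (e + d) (by omega) (by omega)) 2, p1Aut_parity d (2 * n - d) 2, hs d hd1 hd,
    show (2 * n - d) % 3 = (2 * n - d) % 6 % 3 by omega]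
  have ha : d % 2 < 2 := Nat.mod_lt _ (by norm_num)
  have hr : (2 * n - d) % 6 < 6 := Nat.mod_lt _ (by norm_num)
  have hpar : (2 * n - d) % 6 % 2 = d % 2 := by omega
  generalize (2 * n - d) % 6 = r at hr hpar ⊢
  generalize d % 2 = a at ha hpar ⊢
  interval_cases r <;> interval_cases a <;> decide

/-- Sums over `[n]` as sums over `range n`. [folklore] -/
private theorem sum_Icc_one_eq {M : Type*} [AddCommMonoid M] (f : ℕ → M) (n : ℕ) :
    ∑ d ∈ Icc 1 n, f d = ∑ k ∈ range n, f (k + 1) := by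
  induction n with
  | zero => simp
  | succ n ih => rw [Finset.sum_Icc_succ_top (by omega), ih, Finset.sum_range_succ]

/-- Noland's problem via (2.8): `y_{2n} = Σ_{d=1}^{2n} (s_d ≠ (s △ 2)_d) 2^{d-1}
= 2^{2n} - 1 - Σ_{d=1}^{2n} ((2n - d) mod 3 = 1) 2^{d-1}`.
[cite: HinzKlavzarPetr2018, Ch. 2 §2.2.1, Noland's problem via (2.8)] -/
theorem nolandY_two_mul (n : ℕ) :
    nolandY (2 * n) + ∑ d ∈ Icc 1 (2 * n), (if (2 * n - d) % 3 = 1 then 2 ^ (d - 1) else 0) =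
      4 ^ n - 1 := by
  have hs : ∀ d, 1 ≤ d → d ≤ 2 * n → parityState d = ((d % 2 : ℕ) : ZMod 3) := fun d _ _ => rfl
  unfold nolandY
  rw [p1Dist_eq_sum_firstGoal, ← Finset.sum_add_distrib]
  have hc : ∀ d ∈ Icc 1 (2 * n),
      ((if parityState d ≠ firstGoal (2 * n) parityState 2 d then 2 ^ (d - 1) else 0) +
        if (2 * n - d) % 3 = 1 then 2 ^ (d - 1) else 0) = 2 ^ (d - 1) := by
    intro d hd
    rw [Finset.mem_Icc] at hd
    have h := noland_pattern n hs hd.1 hd.2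
    by_cases hq : (2 * n - d) % 3 = 1
    · rw [if_pos hq, if_neg (not_not.mpr (h.mpr hq)), zero_add]
    · rw [if_neg hq, if_pos (fun he => hq (h.mp he)), add_zero]
  rw [Finset.sum_congr rfl hc, sum_Icc_one_eq]
  simp only [Nat.add_sub_cancel]
  rw [Nat.geomSum_eq le_rfl, pow_mul]
  norm_num

/-- Reindexing the excluded discs, `d = M - 1 - 3k`. [folklore] -/
private theorem sum_mod_three_reindex (x : ℕ) : ∀ M : ℕ,
    ∑ d ∈ Icc 1 M, (if (M - d) % 3 = 1 then x ^ (d - 1) else 0) =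
      ∑ k ∈ range ((M + 1) / 3), x ^ (M - 2 - 3 * k)
  | 0 => by simp
  | 1 => by simp
  | 2 => by
    rw [Finset.sum_Icc_succ_top (by omega), Finset.sum_Icc_succ_top (by omega)]
    simp
  | M + 3 => by
    rw [Finset.sum_Icc_succ_top (by omega), Finset.sum_Icc_succ_top (by omega),
      Finset.sum_Icc_succ_top (by omega), show (M + 3 + 1) / 3 = (M + 1) / 3 + 1 by omega,
      Finset.sum_range_succ', show (M + 3 - (M + 1)) % 3 = 2 by omega,
      show (M + 3 - (M + 2)) % 3 = 1 by omega, show (M + 3 - (M + 3)) % 3 = 0 by omega]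
    have hc : ∀ d ∈ Icc 1 M, (if (M + 3 - d) % 3 = 1 then x ^ (d - 1) else 0) =
        if (M - d) % 3 = 1 then x ^ (d - 1) else 0 := by
      intro d hd
      rw [Finset.mem_Icc] at hd
      rw [show (M + 3 - d) % 3 = (M - d) % 3 by omega]
    have hc2 : ∀ k ∈ range ((M + 1) / 3), x ^ (M + 3 - 2 - 3 * (k + 1)) = x ^ (M - 2 - 3 * k) := by
      intro k _
      congr 1
      omega
    rw [Finset.sum_congr rfl hc, sum_mod_three_reindex x M, Finset.sum_congr rfl hc2,
      show M + 2 - 1 = M + 3 - 2 - 3 * 0 by omega]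
    simp

/-- The closed form displayed in the text, for `n ≥ 1` (OUR READING: the inner sum starts at
`k = 0`; the layer of the held copy prints the lower limit `k = 1`, which is off by the `k = 0`
term, e.g. at `n = 1`): `y_{2n} = 4^n (1 - (1/4) Σ_{k=0}^{⌊2(n-1)/3⌋} 8^{-k}) - 1 = ⌊(5/7)4^n⌋`.
[cite: HinzKlavzarPetr2018, Ch. 2 §2.2.1, Noland's problem via (2.8)] -/
theorem nolandY_two_mul_closed {n : ℕ} (hn : 1 ≤ n) :
    (nolandY (2 * n) : ℚ) =
        4 ^ n * (1 - 1 / 4 * ∑ k ∈ range (2 * (n - 1) / 3 + 1), (1 / 8 : ℚ) ^ k) - 1 ∧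
      nolandY (2 * n) = 5 * 4 ^ n / 7 := by
  have hy := nolandY_two_mul n
  have hcl : nolandY (2 * n) = 5 * 4 ^ n / 7 := by
    rw [(noland_closed (2 * n)).2.1, pow_mul]; norm_num
  refine ⟨?_, hcl⟩
  rw [sum_mod_three_reindex 2 (2 * n), show (2 * n + 1) / 3 = 2 * (n - 1) / 3 + 1 by omega] at hy
  have h4 : 1 ≤ 4 ^ n := Nat.one_le_pow _ _ (by norm_num)
  have hyq : (nolandY (2 * n) : ℚ) =
      4 ^ n - 1 - ∑ k ∈ range (2 * (n - 1) / 3 + 1), (2 : ℚ) ^ (2 * n - 2 - 3 * k) := by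
    have := congrArg (fun m : ℕ => (m : ℚ)) hy
    push_cast [Nat.cast_sub h4] at this
    linarith
  have ht : ∀ k ∈ range (2 * (n - 1) / 3 + 1),
      (2 : ℚ) ^ (2 * n - 2 - 3 * k) = 4 ^ n * (1 / 4 * (1 / 8 : ℚ) ^ k) := by
    intro k hk
    rw [Finset.mem_range] at hk
    have hk' : 3 * k + 2 ≤ 2 * n := by omega
    have e : (4 : ℚ) ^ n = 2 ^ (2 * n - 2 - 3 * k) * (4 * 8 ^ k) := by
      rw [show (4 : ℚ) = 2 ^ 2 by norm_num, show (8 : ℚ) = 2 ^ 3 by norm_num, ← pow_mul, ← pow_mul,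
        ← pow_add, ← pow_add]
      congr 1
      omega
    rw [e, one_div_pow]
    field_simp
  rw [hyq, Finset.sum_congr rfl ht, ← Finset.mul_sum, ← Finset.mul_sum]
  ring

/-! ## Proposition 2.22 and Algorithm 11: the closest perfect state -/

/-- Feeding the leading zeros `0^k` above disc `d` to the two P1-automata with goals `j` and
`3 - j`: both add the same powers of `2` while their states are switched `k` times. [folklore] -/
private theorem p1Dist_leading_zeros (s : ℕ → ZMod 3) (d : ℕ) :
    ∀ (k : ℕ) (j : ZMod 3), j ≠ 0 → (∀ e, d < e → e ≤ d + k → s e = 0) →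
      p1Dist (d + k) s j + 2 ^ d = 2 ^ (d + k) + p1Dist d s ((-1) ^ k * j)
  | 0, j, _, _ => by simp [add_comm]
  | k + 1, j, hj, hz => by
    have hs : s (d + k + 1) = 0 := hz _ (by omega) le_rfl
    have h0j : ∀ i : ZMod 3, triOp 0 i = -i := by decide
    rw [show d + (k + 1) = d + k + 1 by omega, p1Dist, hs, if_neg hj.symm, h0j]
    have ih := p1Dist_leading_zeros s d k (-j) (neg_ne_zero.mpr hj)
      (fun e h1 h2 => hz e h1 (by omega))
    have e1 : (-1 : ZMod 3) ^ k * -j = (-1) ^ (k + 1) * j := by ring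
    rw [e1] at ih
    rw [pow_succ 2 (d + k)]
    omega

/-- The peg named in Proposition 2.22 for `s = 0^{n-d} s_d s̄` with `s_d ≠ 0`: `j = s_d` if `n - d`
is even and `j = 3 - s_d` otherwise. [cite: HinzKlavzarPetr2018, Ch. 2 §2.2.1 Prop. 2.22] -/
def closerPeg (n d : ℕ) (s : ℕ → ZMod 3) : ZMod 3 := if (n - d) % 2 = 0 then s d else -s d

/-- **Proposition 2.22**, the inequality: for `n ∈ ℕ` and `s = 0^{n-d} s_d s̄` with `d ∈ [n]`,
`s_d ∈ [2]`, the perfect state `j^n` with `j = s_d` (`n - d` even) resp. `j = 3 - s_d` (`n - d` odd)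
is strictly closer to `s` than `(3 - j)^n`. [cite: HinzKlavzarPetr2018, Ch. 2 §2.2.1 Prop. 2.22] -/
theorem proposition_2_22 {n d : ℕ} {s : ℕ → ZMod 3} (hd1 : 1 ≤ d) (hdn : d ≤ n)
    (hz : ∀ e, d < e → e ≤ n → s e = 0) (hsd : s d ≠ 0) :
    p1Dist n s (closerPeg n d s) < p1Dist n s (-closerPeg n d s) := by
  obtain ⟨k, rfl⟩ : ∃ k, n = d + k := ⟨n - d, by omega⟩
  obtain ⟨d', rfl⟩ : ∃ d', d = d' + 1 := ⟨d - 1, by omega⟩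
  have hne : ∀ a : ZMod 3, a ≠ 0 → a ≠ -a := by decide
  have A := fun (j : ZMod 3) (hj : j ≠ 0) => p1Dist_leading_zeros s (d' + 1) k j hj hz
  have small : p1Dist (d' + 1) s (s (d' + 1)) < 2 ^ d' := by
    rw [(p1Dist_succ_self d' s).1]; exact (p1Dist_succ_self d' s).2
  have large : 2 ^ d' ≤ p1Dist (d' + 1) s (-s (d' + 1)) :=
    (p1Dist_succ_of_ne d' s (hne _ hsd)).2
  unfold closerPeg
  rw [show d' + 1 + k - (d' + 1) = k by omega]
  have A1 := A (s (d' + 1)) hsd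
  have A2 := A (-s (d' + 1)) (neg_ne_zero.mpr hsd)
  rcases Nat.even_or_odd k with hk | hk
  · rw [if_pos (Nat.even_iff.mp hk)]
    rw [hk.neg_one_pow, one_mul] at A1 A2
    omega
  · rw [if_neg (by rw [Nat.odd_iff.mp hk]; decide), neg_neg]
    rw [hk.neg_one_pow, neg_one_mul] at A1 A2
    rw [neg_neg] at A2
    omega

/-- **Proposition 2.22** as stated: for `j ∈ [2]` with `d(s, j^n) < d(s, (3-j)^n)` «we have:»
`j = s_d`«, if n-d is even, and» `j = 3 - s_d` «otherwise.»
[cite: HinzKlavzarPetr2018, Ch. 2 §2.2.1 Prop. 2.22] -/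
theorem proposition_2_22' {n d : ℕ} {s : ℕ → ZMod 3} (hd1 : 1 ≤ d) (hdn : d ≤ n)
    (hz : ∀ e, d < e → e ≤ n → s e = 0) (hsd : s d ≠ 0) {j : ZMod 3} (hj : j ≠ 0)
    (h : p1Dist n s j < p1Dist n s (-j)) : j = closerPeg n d s := by
  by_contra hne
  have hc := proposition_2_22 hd1 hdn hz hsd
  have hcz : closerPeg n d s ≠ 0 := by
    unfold closerPeg; split_ifs
    · exact hsd
    · exact neg_ne_zero.mpr hsd
  have key : ∀ a b : ZMod 3, a ≠ 0 → b ≠ 0 → a ≠ b → a = -b := by decide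
  have e := key _ _ hj hcz hne
  rw [e, neg_neg] at h
  omega

/-- «In particular», `j = s_n` if `s_n ≠ 0`; «this is already a consequence of (2.6) and (2.7)»
(of the sibling: `p1Dist_succ_self`, `p1Dist_succ_of_ne`).
[cite: HinzKlavzarPetr2018, Ch. 2 §2.2.1 Prop. 2.22] -/
theorem closer_of_top_ne_zero {n : ℕ} (hn : 1 ≤ n) {s : ℕ → ZMod 3} (h : s n ≠ 0) :
    p1Dist n s (s n) < p1Dist n s (-s n) := by
  have := proposition_2_22 (d := n) hn le_rfl (fun e h1 h2 => absurd h2 (by omega)) h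
  simpa [closerPeg] using this

/-- «The case of equality can only occur for» `s = 0^n` (cf. Exercise 2.10 a, `exercise_2_10_a`,
and Lemma 2.21). [cite: HinzKlavzarPetr2018, Ch. 2 §2.2.1 Prop. 2.22] -/
theorem p1Dist_one_eq_two_iff (n : ℕ) (s : ℕ → ZMod 3) :
    p1Dist n s 1 = p1Dist n s 2 ↔ IsPerfectOn n s 0 := by
  rcases Nat.eq_zero_or_pos n with rfl | hn
  · simp only [p1Dist, true_iff]
    intro d h1 h0; omega
  · have h12 : (1 : ZMod 3) ≠ 2 := by decide
    have ht : thirdPeg 1 2 = (0 : ZMod 3) := by decide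
    constructor
    · intro h
      by_contra hs
      exact exercise_2_10_a hn s h12 (by rwa [ht]) h
    · intro h
      rw [← ht] at h
      rw [p1Dist_perfect h 1, p1Dist_perfect h 2, if_neg (by decide), if_neg (by decide)]

/-- Algorithm 11, the loop as a structural recursion over the discs `m, m-1, …` with the parity
bit `b`: leading zeros flip `b`; at the first non-zero tit `s_d` the answer is
`j = 1 + (b ⊻ (s_d - 1))`, i.e. `s_d` for `b = 0` and `3 - s_d` for `b = 1` (on `0^m`, which the
book excludes, the value `0`). [cite: HinzKlavzarPetr2018, Ch. 2 §2.2.1 Algorithm 11] -/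
def cpAux : ℕ → (ℕ → ZMod 3) → Bool → ZMod 3
  | 0, _, _ => 0
  | m + 1, s, b => if s (m + 1) = 0 then cpAux m s (!b) else if b then -s (m + 1) else s (m + 1)

/-- Algorithm 11, `cp(n, s)`: the closest perfect state, started with `d ← n`, `b ← 0`.
[cite: HinzKlavzarPetr2018, Ch. 2 §2.2.1 Algorithm 11] -/
def cp (n : ℕ) (s : ℕ → ZMod 3) : ZMod 3 := cpAux n s false

/-- The number of tits Algorithm 11 inspects on `s ∈ T^n` (on `0^n` all `n` of them).
[cite: HinzKlavzarPetr2018, Ch. 2 §2.2.1 Algorithm 11] -/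
def cpTits : ℕ → (ℕ → ZMod 3) → ℕ
  | 0, _ => 0
  | m + 1, s => if s (m + 1) = 0 then cpTits m s + 1 else 1

/-- The loop invariant of Algorithm 11. [folklore] -/
private theorem cpAux_eq {d : ℕ} {s : ℕ → ZMod 3} (hd1 : 1 ≤ d) (hsd : s d ≠ 0) :
    ∀ (k : ℕ) (b : Bool), (∀ e, d < e → e ≤ d + k → s e = 0) →
      cpAux (d + k) s b = (if xor (decide (k % 2 = 1)) b then -s d else s d) ∧
        cpTits (d + k) s = k + 1
  | 0, b, _ => by
    obtain ⟨d', rfl⟩ : ∃ d', d = d' + 1 := ⟨d - 1, by omega⟩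
    simp [cpAux, cpTits, hsd]
  | k + 1, b, hz => by
    have hs : s (d + k + 1) = 0 := hz _ (by omega) le_rfl
    obtain ⟨h1, h2⟩ := cpAux_eq hd1 hsd k (!b) (fun e he1 he2 => hz e he1 (by omega))
    have h3 := (cpAux_eq hd1 hsd k b (fun e he1 he2 => hz e he1 (by omega))).2
    rw [show d + (k + 1) = d + k + 1 by omega]
    simp only [cpAux, cpTits, hs, if_true, h1, h3]
    refine ⟨?_, trivial⟩
    rcases Nat.mod_two_eq_zero_or_one k with hk | hk
    · rw [hk, show (k + 1) % 2 = 1 by omega]; cases b <;> rfl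
    · rw [hk, show (k + 1) % 2 = 0 by omega]; cases b <;> rfl

/-- Algorithm 11 returns the peg of Proposition 2.22 and inspects `n - d + 1` tits, for
`s = 0^{n-d} s_d s̄` with `s_d ≠ 0`. [cite: HinzKlavzarPetr2018, Ch. 2 §2.2.1 Algorithm 11] -/
theorem cp_eq {n d : ℕ} {s : ℕ → ZMod 3} (hd1 : 1 ≤ d) (hdn : d ≤ n)
    (hz : ∀ e, d < e → e ≤ n → s e = 0) (hsd : s d ≠ 0) :
    cp n s = closerPeg n d s ∧ cpTits n s = n - d + 1 := by
  obtain ⟨k, rfl⟩ : ∃ k, n = d + k := ⟨n - d, by omega⟩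
  obtain ⟨h1, h2⟩ := cpAux_eq hd1 hsd k false hz
  refine ⟨?_, by rw [h2]; omega⟩
  unfold cp closerPeg
  rw [h1, show d + k - d = k by omega]
  rcases Nat.mod_two_eq_zero_or_one k with hk | hk
  · rw [hk]; simp
  · rw [hk]; simp

/-- The largest misplaced disc of a state that is not `0^n`. [folklore] -/
private theorem exists_top_ne_zero {n : ℕ} {s : ℕ → ZMod 3} (h : ¬ IsPerfectOn n s 0) :
    ∃ d, 1 ≤ d ∧ d ≤ n ∧ s d ≠ 0 ∧ ∀ e, d < e → e ≤ n → s e = 0 := by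
  induction n with
  | zero => exact absurd (fun d h1 h0 => by omega) h
  | succ n ih =>
    by_cases hs : s (n + 1) = 0
    · have h' : ¬ IsPerfectOn n s 0 := fun hp => h (fun d h1 h2 => by
        rcases Nat.lt_or_ge n d with hlt | hge
        · rw [show d = n + 1 by omega]; exact hs
        · exact hp d h1 hge)
      obtain ⟨d, hd1, hdn, hsd, hz⟩ := ih h'
      exact ⟨d, hd1, by omega, hsd, fun e h1 h2 => by
        rcases Nat.lt_or_ge n e with hlt | hge
        · rw [show e = n + 1 by omega]; exact hs
        · exact hz e h1 hge⟩
    · exact ⟨n + 1, by omega, le_rfl, hs, fun e h1 h2 => absurd h2 (by omega)⟩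

/-- **Algorithm 11 is correct**: for `s ∈ T^n ∖ {0^n}` the perfect state on `cp(n, s) ∈ [2]` is
strictly closer to `s` than the one on `3 - cp(n, s)` (Proposition 2.22).
[cite: HinzKlavzarPetr2018, Ch. 2 §2.2.1 Algorithm 11] -/
theorem cp_spec {n : ℕ} {s : ℕ → ZMod 3} (h : ¬ IsPerfectOn n s 0) :
    cp n s ≠ 0 ∧ p1Dist n s (cp n s) < p1Dist n s (-cp n s) := by
  obtain ⟨d, hd1, hdn, hsd, hz⟩ := exists_top_ne_zero h
  rw [(cp_eq hd1 hdn hz hsd).1]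
  refine ⟨?_, proposition_2_22 hd1 hdn hz hsd⟩
  unfold closerPeg; split_ifs
  · exact hsd
  · exact neg_ne_zero.mpr hsd

/-! ## Exercise 2.15: the average performance of Algorithm 11 -/

/-- Algorithm 11's tit count reads only the discs `1, …, n`.
[cite: HinzKlavzarPetr2018, Exercise 2.15 and Ch. 9; Ch. 2 §2.2.1 Algorithm 11] -/
theorem cpTits_congr {n : ℕ} {s t : ℕ → ZMod 3} (h : ∀ d, 1 ≤ d → d ≤ n → s d = t d) :
    cpTits n s = cpTits n t := by
  induction n with
  | zero => rfl
  | succ n ih =>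
    simp only [cpTits]
    rw [h (n + 1) (by omega) le_rfl, ih (fun d hd1 hdn => h d hd1 (by omega))]

/-- On `0^n` Algorithm 11 would read all `n` tits (the excluded input).
[cite: HinzKlavzarPetr2018, Exercise 2.15 and Ch. 9; Ch. 2 §2.2.1 Algorithm 11] -/
theorem cpTits_perfect {n : ℕ} {s : ℕ → ZMod 3} (h : IsPerfectOn n s 0) : cpTits n s = n := by
  induction n with
  | zero => rfl
  | succ n ih =>
    simp only [cpTits, h (n + 1) (by omega) le_rfl, if_true]
    rw [ih (fun d hd1 hdn => h d hd1 (by omega))]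

/-- Algorithm 11 on an extended word. [folklore] -/
private theorem cpTits_snoc {n : ℕ} (g : Fin n → ZMod 3) (a : ZMod 3) :
    cpTits (n + 1) (stateOf (Fin.snoc g a : Fin (n + 1) → ZMod 3)) =
      if a = 0 then cpTits n (stateOf g) + 1 else 1 := by
  obtain ⟨h1, h2⟩ := stateOf_snoc g a
  simp only [cpTits, h1]
  rw [cpTits_congr h2]

/-- A sum over the three pegs of a two-valued function. [folklore] -/
private theorem sum_peg_ite (x y : ℕ) :
    ∑ a : ZMod 3, (if a = 0 then x else y) = x + 2 * y := by
  rw [show ∑ a : ZMod 3, (if a = 0 then x else y) = (if (0 : ZMod 3) = 0 then x else y) +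
    (if (1 : ZMod 3) = 0 then x else y) + (if (2 : ZMod 3) = 0 then x else y) from
    Fin.sum_univ_three _]
  rw [if_pos rfl, if_neg (by decide), if_neg (by decide)]
  ring

/-- `T^0` has exactly one state, with every index on peg `0`. [folklore] -/
private theorem sum_words_zero (F : (ℕ → ZMod 3) → ℕ) :
    ∑ f : Fin 0 → ZMod 3, F (stateOf f) = F (fun _ => 0) := by
  rw [Fintype.sum_unique]
  congr 1
  funext d
  unfold stateOf
  rw [dif_neg (by omega)]

/-- Exercise 2.15, the total over all of `T^n` (with `0^n` read to the end, `n` tits):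
`2 Σ_{s ∈ T^n} (tits read) = 3 (3^n - 1)`.
[cite: HinzKlavzarPetr2018, Exercise 2.15 and Ch. 9; Ch. 2 §2.2.1 Algorithm 11] -/
theorem sum_cpTits (n : ℕ) : 2 * ∑ f : Fin n → ZMod 3, cpTits n (stateOf f) = 3 * (3 ^ n - 1) := by
  induction n with
  | zero => rw [sum_words_zero (fun t => cpTits 0 t)]; simp [cpTits]
  | succ n ih =>
    rw [sum_stateOf_succ n (fun t => cpTits (n + 1) t)]
    simp_rw [cpTits_snoc]
    have hG : ∀ a : ZMod 3, ∑ g : Fin n → ZMod 3, (if a = 0 then cpTits n (stateOf g) + 1 else 1) =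
        if a = 0 then ∑ g : Fin n → ZMod 3, cpTits n (stateOf g) + 3 ^ n else 3 ^ n := by
      intro a
      split_ifs
      · rw [Finset.sum_add_distrib]; simp [ZMod.card]
      · simp [ZMod.card]
    rw [Finset.sum_congr rfl (fun a _ => hG a), sum_peg_ite]
    have h1 : 1 ≤ 3 ^ n := Nat.one_le_pow _ _ (by norm_num)
    rw [pow_succ]
    omega

/-- Only `0^n` is excluded: the sum over the states with `d(s, 0^n) = 0`. [folklore] -/
private theorem sum_filter_perfect (n : ℕ) :
    ∑ f ∈ Finset.univ.filter (fun f : Fin n → ZMod 3 => p1Dist n (stateOf f) 0 = 0),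
      cpTits n (stateOf f) = n := by
  have hcard := proposition_2_16 n 0 (μ := 0) (Nat.two_pow_pos n)
  rw [pop_zero, pow_zero] at hcard
  rw [Finset.sum_congr rfl (fun f hf => cpTits_perfect
    ((p1Dist_eq_zero_iff n _ 0).mp (Finset.mem_filter.mp hf).2)), Finset.sum_const, hcard,
    smul_eq_mul, one_mul]

/-- **Exercise 2.15**, the count: over the admissible inputs `s ∈ T^n ∖ {0^n}` «the number of tits
entered for all s adds up to» `(3/2)(3^n - 1) - n` (cleared of denominators).
[cite: HinzKlavzarPetr2018, Exercise 2.15 and Ch. 9; Ch. 2 §2.2.1 Algorithm 11] -/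
theorem exercise_2_15_total (n : ℕ) :
    2 * ∑ f ∈ Finset.univ.filter (fun f : Fin n → ZMod 3 => p1Dist n (stateOf f) 0 ≠ 0),
      cpTits n (stateOf f) + 2 * n = 3 * (3 ^ n - 1) := by
  have h := sum_cpTits n
  have hsplit := Finset.sum_filter_add_sum_filter_not Finset.univ
    (fun f : Fin n → ZMod 3 => p1Dist n (stateOf f) 0 = 0) (fun f => cpTits n (stateOf f))
  rw [sum_filter_perfect] at hsplit
  simp only [ne_eq]
  omega

/-- **Exercise 2.15**: «on the average» `3/2 - n (3^n - 1)^{-1}` «tits are checked, i.e.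
asymptotically, for large n, just» `3/2`.
[cite: HinzKlavzarPetr2018, Exercise 2.15 and Ch. 9; Ch. 2 §2.2.1 Algorithm 11] -/
theorem exercise_2_15 {n : ℕ} (hn : 1 ≤ n) :
    ((∑ f ∈ Finset.univ.filter (fun f : Fin n → ZMod 3 => p1Dist n (stateOf f) 0 ≠ 0),
      cpTits n (stateOf f) : ℕ) : ℚ) / (3 ^ n - 1) = 3 / 2 - n / (3 ^ n - 1) := by
  have h := exercise_2_15_total n
  have h3 : 3 ≤ 3 ^ n := by
    calc (3 : ℕ) = 3 ^ 1 := by norm_num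
      _ ≤ 3 ^ n := Nat.pow_le_pow_right (by norm_num) hn
  have hq : ((3 : ℚ) ^ n - 1) ≠ 0 := by
    have : (3 : ℚ) ≤ 3 ^ n := by exact_mod_cast h3
    linarith
  have hc := congrArg (fun m : ℕ => (m : ℚ)) h
  simp only [Nat.cast_add, Nat.cast_mul, Nat.cast_ofNat, Nat.cast_sub (by omega : 1 ≤ 3 ^ n),
    Nat.cast_pow, Nat.cast_one] at hc
  field_simp
  linarith

/-- Exercise 2.15, the states by stopping time: «There are exactly» `2 · 3^{n-k}` «states»
`s ∈ T^n ∖ {0^n}` «for which the algorithm stops after» `k ∈ [n]` «inputs».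
[cite: HinzKlavzarPetr2018, Exercise 2.15 and Ch. 9; Ch. 2 §2.2.1 Algorithm 11] -/
theorem exercise_2_15_count (n : ℕ) {k : ℕ} (hk1 : 1 ≤ k) (hkn : k ≤ n) :
    (Finset.univ.filter fun f : Fin n → ZMod 3 =>
      p1Dist n (stateOf f) 0 ≠ 0 ∧ cpTits n (stateOf f) = k).card = 2 * 3 ^ (n - k) := by
  rw [Finset.card_filter]
  induction n generalizing k with
  | zero => omega
  | succ n ih =>
    rw [sum_stateOf_succ n
      (fun t => if p1Dist (n + 1) t 0 ≠ 0 ∧ cpTits (n + 1) t = k then 1 else 0)]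
    have hP : ∀ (a : ZMod 3) (g : Fin n → ZMod 3),
        p1Dist (n + 1) (stateOf (Fin.snoc g a : Fin (n + 1) → ZMod 3)) 0 =
          (if a = 0 then 0 else 2 ^ n) + p1Dist n (stateOf g) (triOp a 0) := by
      intro a g
      obtain ⟨h1, h2⟩ := stateOf_snoc g a
      simp only [p1Dist, h1]
      rw [p1Dist_congr h2]
    simp_rw [hP, cpTits_snoc]
    have hG : ∀ a : ZMod 3, ∑ g : Fin n → ZMod 3,
        (if ((if a = 0 then 0 else 2 ^ n) + p1Dist n (stateOf g) (triOp a 0) ≠ 0 ∧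
          (if a = 0 then cpTits n (stateOf g) + 1 else 1) = k) then 1 else 0) =
        if a = 0 then ∑ g : Fin n → ZMod 3,
          (if p1Dist n (stateOf g) 0 ≠ 0 ∧ cpTits n (stateOf g) + 1 = k then 1 else 0)
        else (if k = 1 then 3 ^ n else 0) := by
      intro a
      by_cases ha : a = 0
      · subst ha
        simp only [if_true, zero_add, triOp_self]
      · simp only [ha, if_false]
        have hnz : ∀ g : Fin n → ZMod 3, (2 ^ n + p1Dist n (stateOf g) (triOp a 0) ≠ 0) = True :=
          fun g => by simp
        simp only [hnz, true_and]
        by_cases hk : k = 1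
        · subst hk; simp [ZMod.card]
        · rw [if_neg hk]
          simp [Ne.symm hk]
    rw [Finset.sum_congr rfl (fun a _ => hG a), sum_peg_ite]
    by_cases hk : k = 1
    · subst hk
      rw [if_pos rfl, show n + 1 - 1 = n by omega]
      have h0 : ∑ g : Fin n → ZMod 3,
          (if p1Dist n (stateOf g) 0 ≠ 0 ∧ cpTits n (stateOf g) + 1 = 1 then 1 else 0) = 0 := by
        apply Finset.sum_eq_zero
        intro g _
        rw [if_neg]
        rintro ⟨h1, h2⟩
        rcases Nat.eq_zero_or_pos n with hn | hn
        · subst hn; simp [p1Dist] at h1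
        · have : 1 ≤ cpTits n (stateOf g) := by
            obtain ⟨m, rfl⟩ : ∃ m, n = m + 1 := ⟨n - 1, by omega⟩
            simp only [cpTits]; split_ifs <;> omega
          omega
      rw [h0, zero_add]
    · rw [if_neg hk, mul_zero, add_zero]
      have ih' := ih (k := k - 1) (by omega) (by omega)
      rw [show n + 1 - k = n - (k - 1) by omega, ← ih']
      apply Finset.sum_congr rfl
      intro g _
      have e : (cpTits n (stateOf g) + 1 = k) = (cpTits n (stateOf g) = k - 1) := by
        apply propext; omega
      simp only [e]

/-- Exercise 2.15, the two sums of the solution (cleared of denominators, in `ℤ`):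
`Σ_{k=0}^{n-1} 3^k = (3^n - 1)/2` «by Lemma 2.18» and `Σ_{k=1}^{n-1} k·3^k = (3 + (2n-3)·3^n)/4`
(«from formula [162, (2.26)]»; the `k = 0` term is `0`).
[cite: HinzKlavzarPetr2018, Exercise 2.15 and Ch. 9; Ch. 2 §2.2.1 Algorithm 11] -/
theorem exercise_2_15_sums (n : ℕ) :
    2 * ∑ k ∈ range n, (3 : ℤ) ^ k = 3 ^ n - 1 ∧
      4 * ∑ k ∈ range n, (k : ℤ) * 3 ^ k = 3 + (2 * n - 3) * 3 ^ n := by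
  induction n with
  | zero => simp
  | succ n ih =>
    obtain ⟨h1, h2⟩ := ih
    rw [Finset.sum_range_succ, Finset.sum_range_succ, mul_add, mul_add, h1, h2]
    push_cast
    constructor <;> ring

/-- Exercise 2.15: «We therefore have to calculate»
`Σ_{k=1}^{n} k·3^{n-k} = Σ_{k=0}^{n-1} (n-k)·3^k` (`= n Σ_{k=0}^{n-1} 3^k - Σ_{k=1}^{n-1} k·3^k`),
whose value is `(3^{n+1} - 2n - 3)/4`.
[cite: HinzKlavzarPetr2018, Exercise 2.15 and Ch. 9; Ch. 2 §2.2.1 Algorithm 11] -/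
theorem exercise_2_15_value (n : ℕ) :
    ∑ k ∈ Icc 1 n, k * 3 ^ (n - k) = ∑ k ∈ range n, (n - k) * 3 ^ k ∧
      (4 : ℤ) * ∑ k ∈ range n, ((n : ℤ) - k) * 3 ^ k = 3 ^ (n + 1) - 2 * n - 3 := by
  constructor
  · have hI : ∑ k ∈ Icc 1 n, k * 3 ^ (n - k) = ∑ k ∈ range n, (k + 1) * 3 ^ (n - (k + 1)) := by
      induction n with
      | zero => simp
      | succ m ih =>
        rw [Finset.sum_Icc_succ_top (by omega), Finset.sum_range_succ]
        congr 1
        -- the summands below the top agree after `n - k` bookkeeping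
        have e1 : ∑ k ∈ Icc 1 m, k * 3 ^ (m + 1 - k) = ∑ k ∈ Icc 1 m, (k * 3 ^ (m - k)) * 3 := by
          apply Finset.sum_congr rfl
          intro k hk
          rw [Finset.mem_Icc] at hk
          rw [show m + 1 - k = (m - k) + 1 by omega, pow_succ, mul_assoc]
        have e2 : ∑ k ∈ range m, (k + 1) * 3 ^ (m + 1 - (k + 1)) =
            ∑ k ∈ range m, ((k + 1) * 3 ^ (m - (k + 1))) * 3 := by
          apply Finset.sum_congr rfl
          intro k hk
          rw [Finset.mem_range] at hk
          rw [show m + 1 - (k + 1) = (m - (k + 1)) + 1 by omega, pow_succ, mul_assoc]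
        rw [e1, e2, ← Finset.sum_mul, ← Finset.sum_mul, ih]
    rw [hI, ← Finset.sum_range_reflect (fun k => (n - k) * 3 ^ k) n]
    apply Finset.sum_congr rfl
    intro k hk
    rw [Finset.mem_range] at hk
    show (k + 1) * 3 ^ (n - (k + 1)) = (n - (n - 1 - k)) * 3 ^ (n - 1 - k)
    rw [show n - (n - 1 - k) = k + 1 by omega, show n - (k + 1) = n - 1 - k by omega]
  · obtain ⟨h1, h2⟩ := exercise_2_15_sums n
    have e : ∑ k ∈ range n, ((n : ℤ) - k) * 3 ^ k =
        n * ∑ k ∈ range n, (3 : ℤ) ^ k - ∑ k ∈ range n, (k : ℤ) * 3 ^ k := by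
      rw [Finset.mul_sum, ← Finset.sum_sub_distrib]
      apply Finset.sum_congr rfl
      intros
      ring
    rw [e, pow_succ]
    linear_combination (2 * (n : ℤ)) * h1 - h2

/-- Exercise 2.15: the total by stopping times,
`Σ_{s ≠ 0^n} (tits read) = Σ_{k=1}^{n} k · (2·3^{n-k})`.
[cite: HinzKlavzarPetr2018, Exercise 2.15 and Ch. 9; Ch. 2 §2.2.1 Algorithm 11] -/
theorem exercise_2_15_by_stopping_time (n : ℕ) :
    ∑ f ∈ Finset.univ.filter (fun f : Fin n → ZMod 3 => p1Dist n (stateOf f) 0 ≠ 0),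
      cpTits n (stateOf f) = 2 * ∑ k ∈ Icc 1 n, k * 3 ^ (n - k) := by
  have ht := exercise_2_15_total n
  obtain ⟨hr, hv⟩ := exercise_2_15_value n
  rw [hr]
  have h3 : 3 ≤ 3 ^ (n + 1) := by
    calc (3 : ℕ) = 3 ^ 1 := by norm_num
      _ ≤ 3 ^ (n + 1) := Nat.pow_le_pow_right (by norm_num) (by omega)
  have hv' : 4 * ∑ k ∈ range n, (n - k) * 3 ^ k + 2 * n + 3 = 3 ^ (n + 1) := by
    have hc : (((4 * ∑ k ∈ range n, (n - k) * 3 ^ k + 2 * n + 3 : ℕ)) : ℤ) =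
        ((3 ^ (n + 1) : ℕ) : ℤ) := by
      have hs : ∑ k ∈ range n, (((n - k : ℕ) : ℤ)) * 3 ^ k =
          ∑ k ∈ range n, ((n : ℤ) - k) * 3 ^ k := by
        apply Finset.sum_congr rfl
        intro k hk
        rw [Finset.mem_range] at hk
        push_cast [Nat.cast_sub hk.le]
        ring
      push_cast
      rw [hs]
      linear_combination hv
    exact_mod_cast hc
  have h1 : 1 ≤ 3 ^ n := Nat.one_le_pow _ _ (by norm_num)
  rw [pow_succ] at hv'
  omega

/-! ## Exercise 2.14 (Stockmeyer): the bound `Ψ` -/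

/-- Stockmeyer's `Ψ(E) = Σ_{d ∈ E} 2^{d-1}` for `E ∈ 2^{[n]}`.
[cite: HinzKlavzarPetr2018, Exercise 2.14 and Ch. 9; Ch. 2 §2.2.1 (2.8)] -/
def stockmeyerPsi (E : Finset ℕ) : ℕ := ∑ d ∈ E, 2 ^ (d - 1)

/-- `Ψ([n]) = 2^n - 1`. [cite: HinzKlavzarPetr2018, Exercise 2.14 and Ch. 9; Ch. 2 §2.2.1 (2.8)] -/
theorem stockmeyerPsi_Icc (n : ℕ) : stockmeyerPsi (Icc 1 n) = 2 ^ n - 1 := by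
  unfold stockmeyerPsi
  rw [sum_Icc_one_eq]
  simp only [Nat.add_sub_cancel]
  rw [Nat.geomSum_eq le_rfl]
  norm_num

/-- «note that» `0 = Ψ(∅) ≤ Ψ(E) ≤ Ψ([n]) = 2^n - 1`.
[cite: HinzKlavzarPetr2018, Exercise 2.14 and Ch. 9; Ch. 2 §2.2.1 (2.8)] -/
theorem stockmeyerPsi_bounds {n : ℕ} {E : Finset ℕ} (hE : E ⊆ Icc 1 n) :
    stockmeyerPsi ∅ = 0 ∧ stockmeyerPsi E ≤ stockmeyerPsi (Icc 1 n) ∧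
      stockmeyerPsi (Icc 1 n) = 2 ^ n - 1 := by
  refine ⟨by simp [stockmeyerPsi], ?_, stockmeyerPsi_Icc n⟩
  unfold stockmeyerPsi
  exact Finset.sum_le_sum_of_subset hE

/-- `Ψ` of a subset of `[n]` as an indicator sum over `[n]`. [folklore] -/
private theorem stockmeyerPsi_eq_ite {n : ℕ} {E : Finset ℕ} (hE : E ⊆ Icc 1 n) :
    stockmeyerPsi E = ∑ d ∈ Icc 1 n, if d ∈ E then 2 ^ (d - 1) else 0 := by
  unfold stockmeyerPsi
  rw [← Finset.sum_filter, Finset.filter_mem_eq_inter, Finset.inter_eq_right.mpr hE]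

/-- An indicator sum over `[n]` is at most `2^n - 1`. [folklore] -/
private theorem sum_ite_le (n : ℕ) (p : ℕ → Prop) [DecidablePred p] :
    ∑ d ∈ Icc 1 n, (if p d then 2 ^ (d - 1) else 0) ≤ 2 ^ n - 1 := by
  rw [← stockmeyerPsi_Icc n]
  unfold stockmeyerPsi
  refine Finset.sum_le_sum (fun d _ => ?_)
  split_ifs
  · exact le_rfl
  · exact Nat.zero_le _

/-- (2.42) by induction on `n`, for all pairs of goals at once. [folklore] -/
private theorem psi_le_aux (s : ℕ → ZMod 3) (n : ℕ) : ∀ i j : ZMod 3, i ≠ j →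
    ∑ d ∈ Icc 1 n, (if s d = i then 2 ^ (d - 1) else 0) ≤ p1Dist n s j := by
  induction n with
  | zero => intros; simp
  | succ n ih =>
    intro i j hij
    rw [Finset.sum_Icc_succ_top (by omega), p1Dist, Nat.add_sub_cancel]
    have hk := thirdPeg_spec i j hij
    by_cases hi : s (n + 1) = i
    · rw [if_pos hi, hi, if_neg hij, triOp_of_ne hij]
      have := ih i (thirdPeg i j) hk.1.symm
      omega
    · rw [if_neg hi, add_zero]
      by_cases hj : s (n + 1) = j
      · rw [hj, if_pos rfl, triOp_self, zero_add]; exact ih i j hij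
      · rw [if_neg hj]
        have hb := sum_ite_le n (fun d => s d = i)
        have h1 : 1 ≤ 2 ^ n := Nat.one_le_two_pow
        omega

/-- **Exercise 2.14, (2.42)** (Stockmeyer [404, Theorem 1]):
`∀ s ∈ T^n : d(s, j^n) ≥ Ψ(s^{-1}({i}))` for `{i, j} ∈ (T choose 2)`, where
`s^{-1}({i}) = {d ∈ [n] | s_d = i}`.
[cite: HinzKlavzarPetr2018, Exercise 2.14 and Ch. 9; Ch. 2 §2.2.1 (2.8)] -/
theorem exercise_2_14_a (n : ℕ) (s : ℕ → ZMod 3) {i j : ZMod 3} (hij : i ≠ j) :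
    stockmeyerPsi ((Icc 1 n).filter fun d => s d = i) ≤ p1Dist n s j := by
  unfold stockmeyerPsi
  rw [Finset.sum_filter]
  exact psi_le_aux s n i j hij

/-- Stockmeyer's extremal state for `E` (our construction of the state of (2.43), top down): disc
`n` goes to `i` if `n ∈ E` and onto the current goal otherwise, and the goal for the smaller discs
is updated as in Algorithm 10.
[cite: HinzKlavzarPetr2018, Exercise 2.14 and Ch. 9; Ch. 2 §2.2.1 (2.8)] -/
def stockmeyerState (i : ZMod 3) : ℕ → Finset ℕ → ZMod 3 → ℕ → ZMod 3
  | 0, _, j => fun _ => j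
  | n + 1, E, j => fun d =>
    if d = n + 1 then (if n + 1 ∈ E then i else j)
    else stockmeyerState i n E (if n + 1 ∈ E then triOp i j else j) d

/-- The extremal state has `s^{-1}({i}) = E` on `[n]` and `d(s, j^n) = Ψ(E)`. [folklore] -/
private theorem stockmeyerState_spec (i : ZMod 3) (E : Finset ℕ) (n : ℕ) : ∀ j : ZMod 3, j ≠ i →
    (∀ d, 1 ≤ d → d ≤ n → (stockmeyerState i n E j d = i ↔ d ∈ E)) ∧
      p1Dist n (stockmeyerState i n E j) j = ∑ d ∈ Icc 1 n, if d ∈ E then 2 ^ (d - 1) else 0 := by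
  induction n with
  | zero => intro j _; exact ⟨fun d h1 h0 => by omega, by simp [p1Dist]⟩
  | succ n ih =>
    intro j hji
    have hk : ∀ {a b : ZMod 3}, a ≠ b → triOp a b ≠ a := fun {a b} h => by
      rw [triOp_of_ne h]; exact (thirdPeg_spec a b h).1
    set j' : ZMod 3 := if n + 1 ∈ E then triOp i j else j with hj'
    have hj'i : j' ≠ i := by
      rw [hj']; split_ifs
      · exact hk hji.symm
      · exact hji
    obtain ⟨h1, h2⟩ := ih j' hj'i
    have htop : stockmeyerState i (n + 1) E j (n + 1) = if n + 1 ∈ E then i else j := by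
      simp [stockmeyerState]
    have hlow : ∀ d, 1 ≤ d → d ≤ n →
        stockmeyerState i (n + 1) E j d = stockmeyerState i n E j' d := by
      intro d hd1 hdn
      simp only [stockmeyerState, show d ≠ n + 1 by omega, if_false, hj']
    refine ⟨?_, ?_⟩
    · intro d hd1 hdn
      rcases Nat.lt_or_ge n d with hlt | hge
      · rw [show d = n + 1 by omega, htop]
        split_ifs with hm
        · exact ⟨fun _ => hm, fun _ => rfl⟩
        · exact ⟨fun h => absurd h hji, fun h => absurd h hm⟩
      · rw [hlow d hd1 hge]; exact h1 d hd1 hge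
    · rw [p1Dist, htop, p1Dist_congr (fun d hd1 hdn => hlow d hd1 hdn), Finset.sum_Icc_succ_top
        (by omega), Nat.add_sub_cancel]
      by_cases hm : n + 1 ∈ E
      · rw [if_pos hm, if_neg hji.symm, if_pos hm]
        have : triOp i j = j' := by rw [hj', if_pos hm]
        rw [this, h2, add_comm]
      · rw [if_neg hm, if_pos rfl, triOp_self, if_neg hm, zero_add, add_zero]
        have : j = j' := by rw [hj', if_neg hm]
        rw [this]
        exact h2

/-- **Exercise 2.14, (2.43)** (Stockmeyer [404, Theorem 2]), existence: for every `E ∈ 2^{[n]}` the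
state `stockmeyerState i n E j` has `s^{-1}({i}) = E` and `d(s, j^n) = Ψ(E)`.
[cite: HinzKlavzarPetr2018, Exercise 2.14 and Ch. 9; Ch. 2 §2.2.1 (2.8)] -/
theorem exercise_2_14_b_exists {n : ℕ} {E : Finset ℕ} (hE : E ⊆ Icc 1 n) {i j : ZMod 3}
    (hij : i ≠ j) :
    (∀ d, 1 ≤ d → d ≤ n → (stockmeyerState i n E j d = i ↔ d ∈ E)) ∧
      p1Dist n (stockmeyerState i n E j) j = stockmeyerPsi E := by
  rw [stockmeyerPsi_eq_ite hE]
  exact stockmeyerState_spec i E n j hij.symm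

/-- **Exercise 2.14, (2.43)**, uniqueness (on the discs `1, …, n`): a state with `s^{-1}({i}) = E`
and `d(s, j^n) = Ψ(E)` agrees with `stockmeyerState i n E j` on `[n]`.
[cite: HinzKlavzarPetr2018, Exercise 2.14 and Ch. 9; Ch. 2 §2.2.1 (2.8)] -/
theorem exercise_2_14_b_unique {n : ℕ} {E : Finset ℕ} (hE : E ⊆ Icc 1 n) {i j : ZMod 3}
    (hij : i ≠ j) {t : ℕ → ZMod 3} (ht : ∀ d, 1 ≤ d → d ≤ n → (t d = i ↔ d ∈ E))
    (hd : p1Dist n t j = stockmeyerPsi E) :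
    ∀ d, 1 ≤ d → d ≤ n → t d = stockmeyerState i n E j d := by
  rw [stockmeyerPsi_eq_ite hE] at hd
  clear hE
  induction n generalizing j with
  | zero => intro d h1 h0; omega
  | succ n ih =>
    have hk := thirdPeg_spec i j hij
    rw [p1Dist, Finset.sum_Icc_succ_top (by omega), Nat.add_sub_cancel] at hd
    have ht' : ∀ d, 1 ≤ d → d ≤ n → (t d = i ↔ d ∈ E) := fun d h1 h2 => ht d h1 (by omega)
    have hb := sum_ite_le n (fun d => d ∈ E)
    have h1 : 1 ≤ 2 ^ n := Nat.one_le_two_pow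
    intro d hd1 hdn
    by_cases hm : n + 1 ∈ E
    · have htn : t (n + 1) = i := (ht (n + 1) (by omega) le_rfl).mpr hm
      rw [htn, if_neg hij, triOp_of_ne hij, if_pos hm] at hd
      have hd' : p1Dist n t (thirdPeg i j) =
          ∑ d ∈ Icc 1 n, if d ∈ E then 2 ^ (d - 1) else 0 := by omega
      rcases Nat.lt_or_ge n d with hlt | hge
      · rw [show d = n + 1 by omega]
        simp only [stockmeyerState, if_true, if_pos hm]
        exact htn
      · have := ih (j := thirdPeg i j) hk.1.symm ht' hd' d hd1 hge
        simp only [stockmeyerState, show d ≠ n + 1 by omega, if_false, if_pos hm,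
          triOp_of_ne hij]
        exact this
    · have htn : t (n + 1) ≠ i := fun h => hm ((ht (n + 1) (by omega) le_rfl).mp h)
      rw [if_neg hm, add_zero] at hd
      have htj : t (n + 1) = j := by
        by_contra hne
        rw [if_neg hne, triOp_of_ne hne] at hd
        have : thirdPeg (t (n + 1)) j = i := by
          have h3 := thirdPeg_spec (t (n + 1)) j hne
          have uniq := hk.2.2 (t (n + 1)) htn hne
          -- t (n+1) = thirdPeg i j, so thirdPeg (t (n+1)) j = i
          rw [uniq, (thirdPeg_thirdPeg hij).2]
        omega
      rw [htj, if_pos rfl, triOp_self, zero_add] at hd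
      rcases Nat.lt_or_ge n d with hlt | hge
      · rw [show d = n + 1 by omega]
        simp only [stockmeyerState, if_true, if_neg hm]
        exact htj
      · have := ih (j := j) hij ht' hd d hd1 hge
        simp only [stockmeyerState, show d ≠ n + 1 by omega, if_false, if_neg hm]
        exact this

/-! ## Exercise 2.13: the sorting task of Figure 2.9 -/

/-- **Exercise 2.13.** The task of Figure 2.9 (sort the tower `1^8` into the even discs on peg `0`
and the odd discs on peg `2`, i.e. reach `(02)^4`): «The number of moves can be obtained from
Proposition 2.20 as the value of» `d(s, 2^8)`«, which is 182. This number can also be found by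
applying the P1-automaton to the task to get from» `(02)^4` to `1^8`.
[cite: HinzKlavzarPetr2018, Exercise 2.13 and Ch. 9; Ch. 2 §2.2.1 Fig. 2.9] -/
theorem exercise_2_13 :
    p1Dist 8 (stateWord [0, 2, 0, 2, 0, 2, 0, 2]) 1 = 182 ∧ 5 * 2 ^ 8 / 7 = 182 := by
  decide

/-- Exercise 2.13, the moves: in the optimal solution `(02)^4 → 1^8` (`p1Path`, Theorem 2.7) the
discs `1, …, 7` are first united on peg `2` (after `54` moves), then disc `8` moves from peg `0` to
peg `1` (move `55`), and the last move (move `182`) takes disc `1` from peg `2` onto the tower on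
peg `1`; read backwards («we are dealing with the inverse task»; legal moves are reversible,
`HanoiMove.symm`) the sorting starts with disc `1` to peg `2`, the transfer of a `7`-tower from `1`
to `2`, and disc `8` «will only move once from peg 1 to peg 0».
[cite: HinzKlavzarPetr2018, Exercise 2.13 and Ch. 9; Ch. 2 §2.2.1 Fig. 2.9] -/
theorem exercise_2_13_moves :
    (∀ d : Fin 8, p1Path 8 (stateWord [0, 2, 0, 2, 0, 2, 0, 2]) 1 54 (d.val + 1) =
      if d.val + 1 = 8 then 0 else 2) ∧
    (∀ d : Fin 8, p1Path 8 (stateWord [0, 2, 0, 2, 0, 2, 0, 2]) 1 55 (d.val + 1) =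
      if d.val + 1 = 8 then 1 else 2) ∧
    (∀ d : Fin 8, p1Path 8 (stateWord [0, 2, 0, 2, 0, 2, 0, 2]) 1 181 (d.val + 1) =
      if d.val + 1 = 1 then 2 else 1) ∧
    (∀ d : Fin 8, p1Path 8 (stateWord [0, 2, 0, 2, 0, 2, 0, 2]) 1 182 (d.val + 1) = 1) := by
  decide

/-- Exercise 2.13 / Proposition 2.20 at `N = 8`: `x_8 = ⌊(3/7)·256⌋ = 109`,
`y_8 = ⌊(5/7)·256⌋ = 182` (the number of moves of the exercise), `z_8 = ⌊(6/7)·256⌋ = 219`.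
[cite: HinzKlavzarPetr2018, Ch. 2 §2.2.1 Prop. 2.20; Exercise 2.13 and Ch. 9] -/
theorem noland_values : nolandX 8 = 109 ∧ nolandY 8 = 182 ∧ nolandZ 8 = 219 := by
  refine ⟨?_, ?_, ?_⟩ <;> decide

end Literature.Combinatorics.Hinz2018
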